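import Mathlib
import Literature.Computation.Certificates.LieDerivative
import Summits.NavierStokesRegularity.NavierStokesRegularity.Theorems.HeteroclinicTriggerChainTriggerChainTableStatic
import Summits.NavierStokesRegularity.NavierStokesRegularity.Theorems.BarrierStepRungThreeSOSPolyCalculus
import HarnessLib

/-!
# `BarrierStepRungThree`, LINE g2-2 (re-instanced): the trigger-chain WINDOW FIELD in `sdp2lean`
currency and the adapter to the undisturbed decrease clause (window {−1,0,1})

After the design screen of 2026-08-28 (evidence on items stmt-NavierStokesRegularity-23648 and -23942:
below-window tail-rate squeeze ⇒ window `kLo = −1, n = 3`; restart units ⇒ homogeneous goal) the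
intended certificate instance of the line is: Tao's `ε₀ = 1` cascade of the trigger-chain pencil
`α₀ + βσ` (tree: `TriggerChainTable.*`), window shells {−1,0,1}, boundary shells −2 and 2, clock
`v x = P.eval (L x)` and goal `g x = G.eval (L x)` for sparse rational polynomials `P, G : SOS.Poly`
in the twelve window variables (index `4j + i`), certified by `sdp2lean` (`Literature/Computation/
Certificates`). This file supplies, without new definitions (tables and coordinate maps enter
through their defining equations, as in `TriggerChainTable.stub_static`):

* `eval_congr`, `numVars_pderiv_le` — LOCALITY of `SOS.Poly.eval` (only variables `< numVars`
  matter), so the clock (window variables `< 12`) and the field (window + boundary + `√2`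
  variables `< 21`) share one evaluation point;
* `quadTerm_pencil`, `inTableClass_pencil` — linearity of the cascade nonlinearity in the table and
  the comparability `InTableClass (2/β) (α₀ + βσ)` for `0 < β ≤ 1`;
* `quadTerm_pencil_window_eq_eval_field` — the LATTICE IDENTITY: the window restriction of
  `quadTerm 1 (α₀ + βσ)` at any lattice state `S` equals the value of an explicit twelve-component
  `List SOS.Poly` field `F` (weights `Λ₋₂ = 1/32`, `Λ₋₁ = √2/8`, `Λ₀ = 1`, `Λ₁ = 4√2`, `√2` carried as
  variable `20`) at any point reading `S` in the stated variable order;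
* `decrease_box_of_sos` — the ADAPTER: an `sdp2lean`-shaped bound `(lieDeriv F P)(y) ≤ m` on the box
  {`y₂₀² = 2, y₂₀ ≥ 0, P ≤ 0, G > 0`, window caps, boundary caps} gives verbatim the hypothesis `hdec`
  of `WindowBox.decrease_of_box(_le)` (Theorems/BarrierStepRungThreeWindowBoxReduction) with
  `kLo := −1`, `n := 3`, via `SOSPolyCalculus.fderiv_eval_comp_apply` (Theorems/…SOSPolyCalculus).

HONEST FRAMING: algebra/bookkeeping for the certificate instance of a line on class rung TL-M3 about
a MODEL lattice table; no certificate is produced here, no item is closed, and nothing in this file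
is a statement about the Navier–Stokes equations.
-/

noncomputable section

-- the sub-problem namespace `Summit.NavierStokesRegularity.NavierStokesRegularity` repeats the summit name by design (D-0017)
set_option linter.dupNamespace false

namespace Summit.NavierStokesRegularity.NavierStokesRegularity.Theorems

namespace TriggerWindow

open Finset
open Literature.Analysis.FluidPDE Literature.Analysis.FluidPDE.TaoCascade
open Literature.Computation.Certificates Literature.Computation.Certificates.SOS
open Literature.Computation.Certificates.SOS.Poly Literature.Computation.Certificates.SOS.Monomial

/-! ### Locality of `SOS.Poly.eval`: only variables below `numVars` matter -/

/-- A monomial read from index `k₀` only sees the variables `k₀, …, k₀ + |m| − 1`. [folklore] -/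
theorem evalFrom_congr {R : Type*} [CommSemiring R] {y y' : ℕ → R} :
    ∀ (m : Monomial) (k₀ : ℕ), (∀ j, k₀ ≤ j → j < k₀ + m.length → y j = y' j) →
      Monomial.evalFrom y k₀ m = Monomial.evalFrom y' k₀ m
  | [], _, _ => by simp
  | e :: es, k₀, h => by
      simp only [evalFrom_cons]
      rw [h k₀ le_rfl (by simp),
        evalFrom_congr es (k₀ + 1) fun j hj hj' => h j (by omega) (by simp only [List.length_cons]; omega)]

/-- **Locality.** Two points agreeing on the variables `< numVars P` give the same value of `P`.
[folklore] -/
theorem eval_congr {y y' : ℕ → ℝ} :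
    ∀ P : Poly, (∀ k < numVars P, y k = y' k) → (Poly.eval y P : ℝ) = Poly.eval y' P
  | [], _ => by simp
  | (m, c) :: P, h => by
      have hm : ∀ j, 0 ≤ j → j < 0 + m.length → y j = y' j :=
        fun j _ hj => h j (lt_of_lt_of_le (by simpa using hj) (le_max_left _ _))
      have hP : ∀ k < numVars P, y k = y' k := fun k hk => h k (lt_of_lt_of_le hk (le_max_right _ _))
      rw [Poly.eval_cons, Poly.eval_cons, Monomial.eval_eq, Monomial.eval_eq, evalFrom_congr m 0 hm,
        eval_congr P hP]

/-- Decrementing an exponent does not change the length of the exponent vector. [folklore] -/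
theorem length_dec : ∀ (k : ℕ) (m : Monomial), (dec k m).length = m.length
  | _, [] => by simp
  | 0, e :: es => by simp [dec]
  | j + 1, e :: es => by simp [dec, length_dec j es]

/-- The partial derivative uses no new variables: `numVars (∂ₖ P) ≤ numVars P`. [folklore] -/
theorem numVars_pderiv_le (k : ℕ) : ∀ P : Poly, numVars (pderiv k P) ≤ numVars P
  | [] => by simp [pderiv, numVars]
  | (m, c) :: P => by
      have ih := numVars_pderiv_le k P
      unfold pderiv at ih ⊢
      rw [List.filterMap_cons]
      split_ifs with h
      · exact ih.trans (le_max_right _ _)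
      · show max (dec k m).length _ ≤ max m.length (numVars P)
        rw [length_dec]
        exact max_le_max le_rfl ih

/-! ### The trigger-chain pencil `α₀ + βσ`: linearity, closed forms, comparability -/

/-- The cascade nonlinearity is linear in the table: `quadTerm (α₀ + βσ) = quadTerm α₀ + β·quadTerm σ`.
[folklore] -/
theorem quadTerm_pencil (ε₀ β : ℝ) {m : ℕ} (α₀ σ : Fin m → Fin m → Fin m → ℤ × ℤ × ℤ → ℝ)
    (X : Fin m → ℤ → ℝ → ℝ) (i : Fin m) (n : ℤ) (t : ℝ) :
    quadTerm ε₀ (fun a b c μ => α₀ a b c μ + β * σ a b c μ) X i n t =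
      quadTerm ε₀ α₀ X i n t + β * quadTerm ε₀ σ X i n t := by
  unfold quadTerm
  simp only [add_mul, Finset.sum_add_distrib, Finset.mul_sum]
  congr 1
  refine Finset.sum_congr rfl fun _ _ => Finset.sum_congr rfl fun _ _ =>
    Finset.sum_congr rfl fun _ _ => ?_
  ring

/-- `2^(5/2) = 4√2`. [folklore] -/
theorem two_rpow_five_halves : (2 : ℝ) ^ ((5 : ℝ) / 2) = 4 * Real.sqrt 2 := by
  rw [show (5 : ℝ) / 2 = (2 : ℕ) + (1 / 2 : ℝ) by norm_num, Real.rpow_add two_pos,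
    Real.rpow_natCast, Real.sqrt_eq_rpow]
  norm_num

/-- `2^(−5/2) = √2/8`. [folklore] -/
theorem two_rpow_neg_five_halves : (2 : ℝ) ^ (-((5 : ℝ) / 2)) = Real.sqrt 2 / 8 := by
  rw [Real.rpow_neg zero_le_two, two_rpow_five_halves]
  have h2 : Real.sqrt 2 * Real.sqrt 2 = 2 := Real.mul_self_sqrt zero_le_two
  have hs : 0 < Real.sqrt 2 := Real.sqrt_pos.2 two_pos
  field_simp
  nlinarith [h2]


/-- **The trigger-chain pencil is comparable with spread `2/β`.** For the explicit tables `α₀`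
(trigger/transfer) and `σ` (seed) of `TriggerChainTable` (given by their defining equations) and
`0 < β ≤ 1`, the table `α₀ + βσ` is symmetric, cancelling and `(2/β)`-comparable:
`InTableClass (2/β) (α₀ + βσ)`. (Standalone form of a clause of `TriggerChainTable.stub_static`, for
instantiating the `InTableClass R α` clause of the window certificate with `R := 2/β`.)
[cite: Tao2016AveragedNS, §4 (4.2)–(4.3); tree `TriggerChainTable.heteroclinicTriggerChain_tables_values`] -/
theorem inTableClass_pencil (τ α₀ τ' σ : Fin 4 → Fin 4 → Fin 4 → ℤ × ℤ × ℤ → ℝ)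
    (hτ : τ = fun (a b c : Fin 4) (μ : ℤ × ℤ × ℤ) => if a = 0 ∧ b = 1 ∧ c = 1 then
      (if μ = (0, 0, 0) then (1 : ℝ) / 2 else if μ = (1, 0, 0) then -(1 / 2) else 0) else 0)
    (hα₀ : α₀ = fun (a b c : Fin 4) (μ : ℤ × ℤ × ℤ) => τ a b c μ - τ c b a (μ.2.2, μ.2.1, μ.1) +
      τ b a c (μ.2.1, μ.1, μ.2.2) - τ c a b (μ.2.2, μ.1, μ.2.1))
    (hτ' : τ' = fun (a b c : Fin 4) (μ : ℤ × ℤ × ℤ) => if a = 0 ∧ b = 1 ∧ c = 1 then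
      (if μ = (0, 0, 1) then (1 : ℝ) / 2 else 0) else 0)
    (hσ : σ = fun (a b c : Fin 4) (μ : ℤ × ℤ × ℤ) => τ' a b c μ - τ' c b a (μ.2.2, μ.2.1, μ.1) +
      τ' b a c (μ.2.1, μ.1, μ.2.2) - τ' c a b (μ.2.2, μ.1, μ.2.1))
    (β : ℝ) (hβ : 0 < β) (hβ1 : β ≤ 1) :
    InTableClass (2 / β) (fun a b c μ => α₀ a b c μ + β * σ a b c μ) := by
  have hval := TriggerChainTable.heteroclinicTriggerChain_tables_values τ α₀ τ' σ hτ hα₀ hτ' hσ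
  have hsymα := TriggerChainTable.heteroclinicTriggerChain_isSymmetricCoeff_of_skew τ α₀ hα₀
  have hsymσ := TriggerChainTable.heteroclinicTriggerChain_isSymmetricCoeff_of_skew τ' σ hσ
  have hcanα := TriggerChainTable.heteroclinicTriggerChain_isCancellingCoeff_of_skew τ α₀ hα₀
  have hcanσ := TriggerChainTable.heteroclinicTriggerChain_isCancellingCoeff_of_skew τ' σ hσ
  refine ⟨?_, ?_, ?_⟩
  · intro a b c μ₁ μ₂ μ₃ hμ
    dsimp only
    rw [hsymα a b c μ₁ μ₂ μ₃ hμ, hsymσ a b c μ₁ μ₂ μ₃ hμ]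
  · intro a b c μ₁ μ₂ μ₃ hμ
    dsimp only
    have h1 := hcanα a b c μ₁ μ₂ μ₃ hμ
    have h2 := hcanσ a b c μ₁ μ₂ μ₃ hμ
    linear_combination h1 + β * h2
  · intro a b c μ hμ
    dsimp only
    rw [inv_div]
    obtain ⟨hvα, hvσ, hdisj⟩ := hval a b c μ hμ
    rcases hdisj with h0 | h0 <;> rw [h0]
    · rw [zero_add]
      rcases hvσ with h | h | h <;> rw [h]
      · simp
      · rw [abs_of_pos (by positivity)]
        exact ⟨by linarith, Or.inr (by linarith)⟩
      · rw [mul_neg, abs_neg, abs_of_pos (by positivity)]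
        exact ⟨by linarith, Or.inr (by linarith)⟩
    · rw [mul_zero, add_zero]
      rcases hvα with h | h | h | h | h <;> rw [h]
      · simp
      · rw [abs_of_pos (by norm_num)]
        exact ⟨by norm_num, Or.inr (by linarith)⟩
      · rw [abs_neg, abs_of_pos (by norm_num)]
        exact ⟨by norm_num, Or.inr (by linarith)⟩
      · rw [abs_one]
        exact ⟨le_rfl, Or.inr (by linarith)⟩
      · rw [abs_neg, abs_one]
        exact ⟨le_rfl, Or.inr (by linarith)⟩

/-! ### The window field in `SOS.Poly` currency and the lattice identity -/

/-- Every index below `12` is a window index `4j + i`. [folklore] -/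
theorem exists_window_index (k : ℕ) (hk : k < 12) :
    ∃ (i : Fin 4) (j : Fin 3), k = 4 * (j : ℕ) + (i : ℕ) :=
  ⟨⟨k % 4, by omega⟩, ⟨k / 4, by omega⟩, by simp only; omega⟩

section Field

variable (τ α₀ τ' σ : Fin 4 → Fin 4 → Fin 4 → ℤ × ℤ × ℤ → ℝ)
  (hτ : τ = fun (a b c : Fin 4) (μ : ℤ × ℤ × ℤ) => if a = 0 ∧ b = 1 ∧ c = 1 then
    (if μ = (0, 0, 0) then (1 : ℝ) / 2 else if μ = (1, 0, 0) then -(1 / 2) else 0) else 0)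
  (hα₀ : α₀ = fun (a b c : Fin 4) (μ : ℤ × ℤ × ℤ) => τ a b c μ - τ c b a (μ.2.2, μ.2.1, μ.1) +
    τ b a c (μ.2.1, μ.1, μ.2.2) - τ c a b (μ.2.2, μ.1, μ.2.1))
  (hτ' : τ' = fun (a b c : Fin 4) (μ : ℤ × ℤ × ℤ) => if a = 0 ∧ b = 1 ∧ c = 1 then
    (if μ = (0, 0, 1) then (1 : ℝ) / 2 else 0) else 0)
  (hσ : σ = fun (a b c : Fin 4) (μ : ℤ × ℤ × ℤ) => τ' a b c μ - τ' c b a (μ.2.2, μ.2.1, μ.1) +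
    τ' b a c (μ.2.1, μ.1, μ.2.2) - τ' c a b (μ.2.2, μ.1, μ.2.1))

include hτ hα₀ hτ' hσ

/-- **Lattice identity.** For the trigger-chain pencil `α₀ + βσ` (tables given by their defining
equations, as in `TriggerChainTable.stub_static`), the window restriction of the `ε₀ = 1` cascade
nonlinearity at a lattice state `S` is the value of the explicit sparse rational field (twelve
`SOS.Poly` components, index `4j+i`, variable `20` = `√2`) at any point `pt S` reading the window
{−1,0,1} at `4j+i`, the boundary shells `−2`, `2` at `12+i`, `16+i`, and `√2` at `20`.
[cite: Tao2016AveragedNS, §4 (4.8); tree `TriggerChainTable.heteroclinicTriggerChain_quadTerm_trigger/seed`] -/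
theorem quadTerm_pencil_window_eq_eval_field (β : ℚ) (F : List Poly)
    (hF : F = [[(([0, 2, 0, 0, 0, 0, 0, 0, 0, 0, 0, 0, 0, 0, 0, 0, 0, 0, 0, 0, 1] : List ℕ), ((-1 : ℚ) / 8)),
            (([0, 0, 0, 0, 0, 0, 0, 0, 0, 0, 0, 0, 0, 2] : List ℕ), ((1 : ℚ) / 32)),
            (([0, 1, 0, 0, 0, 1, 0, 0, 0, 0, 0, 0, 0, 0, 0, 0, 0, 0, 0, 0, 1] : List ℕ), ((-1 : ℚ) / 8) * β)],
          [(([1, 1, 0, 0, 0, 0, 0, 0, 0, 0, 0, 0, 0, 0, 0, 0, 0, 0, 0, 0, 1] : List ℕ), ((1 : ℚ) / 8)),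
            (([0, 1, 0, 0, 1, 0, 0, 0, 0, 0, 0, 0, 0, 0, 0, 0, 0, 0, 0, 0, 1] : List ℕ), ((-1 : ℚ) / 8)),
            (([0, 0, 0, 0, 0, 0, 0, 0, 0, 0, 0, 0, 1, 1] : List ℕ), ((1 : ℚ) / 32) * β)],
          ([] : Poly),
          ([] : Poly),
          [(([0, 0, 0, 0, 0, 2] : List ℕ), (-1 : ℚ)),
            (([0, 2, 0, 0, 0, 0, 0, 0, 0, 0, 0, 0, 0, 0, 0, 0, 0, 0, 0, 0, 1] : List ℕ), ((1 : ℚ) / 8)),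
            (([0, 0, 0, 0, 0, 1, 0, 0, 0, 1] : List ℕ), (-1 : ℚ) * β)],
          [(([0, 0, 0, 0, 1, 1] : List ℕ), (1 : ℚ)),
            (([0, 0, 0, 0, 0, 1, 0, 0, 1] : List ℕ), (-1 : ℚ)),
            (([1, 1, 0, 0, 0, 0, 0, 0, 0, 0, 0, 0, 0, 0, 0, 0, 0, 0, 0, 0, 1] : List ℕ), ((1 : ℚ) / 8) * β)],
          ([] : Poly),
          ([] : Poly),
          [(([0, 0, 0, 0, 0, 0, 0, 0, 0, 2, 0, 0, 0, 0, 0, 0, 0, 0, 0, 0, 1] : List ℕ), (-4 : ℚ)),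
            (([0, 0, 0, 0, 0, 2] : List ℕ), (1 : ℚ)),
            (([0, 0, 0, 0, 0, 0, 0, 0, 0, 1, 0, 0, 0, 0, 0, 0, 0, 1, 0, 0, 1] : List ℕ), (-4 : ℚ) * β)],
          [(([0, 0, 0, 0, 0, 0, 0, 0, 1, 1, 0, 0, 0, 0, 0, 0, 0, 0, 0, 0, 1] : List ℕ), (4 : ℚ)),
            (([0, 0, 0, 0, 0, 0, 0, 0, 0, 1, 0, 0, 0, 0, 0, 0, 1, 0, 0, 0, 1] : List ℕ), (-4 : ℚ)),
            (([0, 0, 0, 0, 1, 1] : List ℕ), (1 : ℚ) * β)],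
          ([] : Poly),
          ([] : Poly)])
    (pt : (Fin 4 → ℤ → ℝ) → ℕ → ℝ)
    (hwin : ∀ (S : Fin 4 → ℤ → ℝ) (i : Fin 4) (j : Fin 3), pt S (4 * (j : ℕ) + (i : ℕ)) = S i (-1 + (j : ℕ)))
    (hbm : ∀ (S : Fin 4 → ℤ → ℝ) (i : Fin 4), pt S (12 + (i : ℕ)) = S i (-2))
    (hbp : ∀ (S : Fin 4 → ℤ → ℝ) (i : Fin 4), pt S (16 + (i : ℕ)) = S i 2)
    (h20 : ∀ S : Fin 4 → ℤ → ℝ, pt S 20 = Real.sqrt 2)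
    (S : Fin 4 → ℤ → ℝ) (i : Fin 4) (j : Fin 3) :
    quadTerm 1 (fun a b c μ => α₀ a b c μ + (β : ℝ) * σ a b c μ) (fun i' k' (_ : ℝ) => S i' k') i
        (-1 + (j : ℕ)) 0 =
      Poly.eval (pt S) (F.getD (4 * (j : ℕ) + (i : ℕ)) []) := by
  obtain ⟨hq0, hq1, hq2, hq3⟩ :=
    TriggerChainTable.heteroclinicTriggerChain_quadTerm_trigger τ α₀ hτ hα₀
  obtain ⟨hs0, hs1, hs2, hs3⟩ :=
    TriggerChainTable.heteroclinicTriggerChain_quadTerm_seed τ' σ hτ' hσ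
  have p0 : pt S 0 = S 0 (-1) := by simpa using hwin S 0 0
  have p1 : pt S 1 = S 1 (-1) := by simpa using hwin S 1 0
  have p2 : pt S 2 = S 2 (-1) := by simpa using hwin S 2 0
  have p3 : pt S 3 = S 3 (-1) := by simpa using hwin S 3 0
  have p4 : pt S 4 = S 0 (0) := by simpa using hwin S 0 1
  have p5 : pt S 5 = S 1 (0) := by simpa using hwin S 1 1
  have p6 : pt S 6 = S 2 (0) := by simpa using hwin S 2 1
  have p7 : pt S 7 = S 3 (0) := by simpa using hwin S 3 1
  have p8 : pt S 8 = S 0 (1) := by simpa using hwin S 0 2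
  have p9 : pt S 9 = S 1 (1) := by simpa using hwin S 1 2
  have p10 : pt S 10 = S 2 (1) := by simpa using hwin S 2 2
  have p11 : pt S 11 = S 3 (1) := by simpa using hwin S 3 2
  have p12 : pt S 12 = S 0 (-2) := by simpa using hbm S 0
  have p13 : pt S 13 = S 1 (-2) := by simpa using hbm S 1
  have p14 : pt S 14 = S 2 (-2) := by simpa using hbm S 2
  have p15 : pt S 15 = S 3 (-2) := by simpa using hbm S 3
  have p16 : pt S 16 = S 0 2 := by simpa using hbp S 0
  have p17 : pt S 17 = S 1 2 := by simpa using hbp S 1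
  have p18 : pt S 18 = S 2 2 := by simpa using hbp S 2
  have p19 : pt S 19 = S 3 2 := by simpa using hbp S 3
  have p20 : pt S 20 = Real.sqrt 2 := h20 S
  have e0 : (⟨0, by norm_num⟩ : Fin 4) = 0 := rfl
  have e1 : (⟨1, by norm_num⟩ : Fin 4) = 1 := rfl
  have e2 : (⟨2, by norm_num⟩ : Fin 4) = 2 := rfl
  have e3 : (⟨3, by norm_num⟩ : Fin 4) = 3 := rfl
  subst hF
  rw [quadTerm_pencil]
  fin_cases i <;> fin_cases j
  all_goals simp only [e0, e1, e2, e3, Nat.cast_zero, Nat.cast_one, Nat.cast_ofNat, Int.reduceAdd,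
    Int.reduceNeg]
  all_goals (first | rw [hq0, hs0] | rw [hq1, hs1] | rw [hq2, hs2] | rw [hq3, hs3])
  all_goals norm_num [List.getD, Poly.eval, Monomial.eval, Monomial.evalFrom, p0, p1, p2, p3, p4, p5, p6, p7, p8, p9, p10, p11, p12, p13, p14, p15, p16, p17, p18, p19, p20]
  all_goals (try rw [two_rpow_neg_five_halves])
  all_goals (try rw [two_rpow_five_halves])
  all_goals ring

/-- **Adapter: the undisturbed decrease clause on the BOX from an `sdp2lean`-style bound.** For the
trigger-chain pencil, window {−1,0,1} (`kLo = −1`, `n = 3`), a clock `v x := P.eval (L x)` and goal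
`g x := G.eval (L x)` given by sparse rational polynomials in the twelve window variables (`numVars ≤ 12`,
`L` the window coordinates `L x (4j+i) = x i j` of `SOSPolyCalculus.exists_windowCoordinates 3`), a
bound `(lieDeriv F P)(y) ≤ m` (`m = −2γ`, or `−(γ+δ)` in the split format) valid at every point `y` of the semialgebraic box
{`y₂₀² = 2`, `y₂₀ ≥ 0`, `P(y) ≤ 0`, `G(y) > 0`, window caps `y_(4j+i)² ≤ 2Φ i j`, boundary caps
`|y_(12+i)| ≤ q(−2)`, `|y_(16+i)| ≤ q(2)`} — exactly what an `sdp2lean` certificate for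
`p := m − lieDeriv F P` with these `gs`/`hs` delivers — yields the hypothesis `hdec` of
`WindowBox.decrease_of_box` / `decrease_of_box_le` (Theorems/BarrierStepRungThreeWindowBoxReduction,
`kLo := -1`, `n := 3`) for this table and window.
[cite: RoucheHabetsLaloy1977, Ch. I §3.1 eq. (3.1); Tao2016AveragedNS §4 (4.8)] -/
theorem decrease_box_of_sos (β : ℚ) (F : List Poly)
    (hF : F = [[(([0, 2, 0, 0, 0, 0, 0, 0, 0, 0, 0, 0, 0, 0, 0, 0, 0, 0, 0, 0, 1] : List ℕ), ((-1 : ℚ) / 8)),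
            (([0, 0, 0, 0, 0, 0, 0, 0, 0, 0, 0, 0, 0, 2] : List ℕ), ((1 : ℚ) / 32)),
            (([0, 1, 0, 0, 0, 1, 0, 0, 0, 0, 0, 0, 0, 0, 0, 0, 0, 0, 0, 0, 1] : List ℕ), ((-1 : ℚ) / 8) * β)],
          [(([1, 1, 0, 0, 0, 0, 0, 0, 0, 0, 0, 0, 0, 0, 0, 0, 0, 0, 0, 0, 1] : List ℕ), ((1 : ℚ) / 8)),
            (([0, 1, 0, 0, 1, 0, 0, 0, 0, 0, 0, 0, 0, 0, 0, 0, 0, 0, 0, 0, 1] : List ℕ), ((-1 : ℚ) / 8)),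
            (([0, 0, 0, 0, 0, 0, 0, 0, 0, 0, 0, 0, 1, 1] : List ℕ), ((1 : ℚ) / 32) * β)],
          ([] : Poly),
          ([] : Poly),
          [(([0, 0, 0, 0, 0, 2] : List ℕ), (-1 : ℚ)),
            (([0, 2, 0, 0, 0, 0, 0, 0, 0, 0, 0, 0, 0, 0, 0, 0, 0, 0, 0, 0, 1] : List ℕ), ((1 : ℚ) / 8)),
            (([0, 0, 0, 0, 0, 1, 0, 0, 0, 1] : List ℕ), (-1 : ℚ) * β)],
          [(([0, 0, 0, 0, 1, 1] : List ℕ), (1 : ℚ)),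
            (([0, 0, 0, 0, 0, 1, 0, 0, 1] : List ℕ), (-1 : ℚ)),
            (([1, 1, 0, 0, 0, 0, 0, 0, 0, 0, 0, 0, 0, 0, 0, 0, 0, 0, 0, 0, 1] : List ℕ), ((1 : ℚ) / 8) * β)],
          ([] : Poly),
          ([] : Poly),
          [(([0, 0, 0, 0, 0, 0, 0, 0, 0, 2, 0, 0, 0, 0, 0, 0, 0, 0, 0, 0, 1] : List ℕ), (-4 : ℚ)),
            (([0, 0, 0, 0, 0, 2] : List ℕ), (1 : ℚ)),
            (([0, 0, 0, 0, 0, 0, 0, 0, 0, 1, 0, 0, 0, 0, 0, 0, 0, 1, 0, 0, 1] : List ℕ), (-4 : ℚ) * β)],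
          [(([0, 0, 0, 0, 0, 0, 0, 0, 1, 1, 0, 0, 0, 0, 0, 0, 0, 0, 0, 0, 1] : List ℕ), (4 : ℚ)),
            (([0, 0, 0, 0, 0, 0, 0, 0, 0, 1, 0, 0, 0, 0, 0, 0, 1, 0, 0, 0, 1] : List ℕ), (-4 : ℚ)),
            (([0, 0, 0, 0, 1, 1] : List ℕ), (1 : ℚ) * β)],
          ([] : Poly),
          ([] : Poly)])
    (pt : (Fin 4 → ℤ → ℝ) → ℕ → ℝ)
    (hwin : ∀ (S : Fin 4 → ℤ → ℝ) (i : Fin 4) (j : Fin 3), pt S (4 * (j : ℕ) + (i : ℕ)) = S i (-1 + (j : ℕ)))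
    (hbm : ∀ (S : Fin 4 → ℤ → ℝ) (i : Fin 4), pt S (12 + (i : ℕ)) = S i (-2))
    (hbp : ∀ (S : Fin 4 → ℤ → ℝ) (i : Fin 4), pt S (16 + (i : ℕ)) = S i 2)
    (h20 : ∀ S : Fin 4 → ℤ → ℝ, pt S 20 = Real.sqrt 2)
    (P G : Poly) (hP : numVars P ≤ 12) (hG : numVars G ≤ 12)
    (L : (Fin 4 → Fin 3 → ℝ) →L[ℝ] (ℕ → ℝ))
    (hL : ∀ (x : Fin 4 → Fin 3 → ℝ) (i : Fin 4) (j : Fin 3), L x (4 * (j : ℕ) + (i : ℕ)) = x i j)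
    {q : ℤ → ℝ} {Φ : Fin 4 → Fin 3 → ℝ} {m : ℝ}
    (hsos : ∀ y : ℕ → ℝ, y 20 * y 20 = 2 → 0 ≤ y 20 → (Poly.eval y P : ℝ) ≤ 0 → 0 < (Poly.eval y G : ℝ) →
      (∀ (i : Fin 4) (j : Fin 3), y (4 * (j : ℕ) + (i : ℕ)) ^ 2 ≤ 2 * Φ i j) →
      (∀ i : Fin 4, |y (12 + (i : ℕ))| ≤ q (-2)) → (∀ i : Fin 4, |y (16 + (i : ℕ))| ≤ q 2) →
      (Poly.eval y (lieDeriv F P) : ℝ) ≤ m) :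
    ∀ S : Fin 4 → ℤ → ℝ,
      (fun x : Fin 4 → Fin 3 → ℝ => (Poly.eval (L x) P : ℝ)) (fun i (j : Fin 3) => S i ((-1 : ℤ) + ((j : ℕ) : ℤ))) ≤ 0 →
      (∀ (i : Fin 4) (k : ℤ), (k < (-1 : ℤ) ∨ (-1 : ℤ) + ((3 : ℕ) : ℤ) ≤ k) → |S i k| ≤ q k) →
      (∀ (i : Fin 4) (j : Fin 3), S i ((-1 : ℤ) + ((j : ℕ) : ℤ)) ^ 2 ≤ 2 * Φ i j) →
      0 < (fun x : Fin 4 → Fin 3 → ℝ => (Poly.eval (L x) G : ℝ)) (fun i (j : Fin 3) => S i ((-1 : ℤ) + ((j : ℕ) : ℤ))) →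
      (fderiv ℝ (fun x : Fin 4 → Fin 3 → ℝ => (Poly.eval (L x) P : ℝ))
          (fun i (j : Fin 3) => S i ((-1 : ℤ) + ((j : ℕ) : ℤ))))
        (fun i (j : Fin 3) => quadTerm 1 (fun a b c μ => α₀ a b c μ + (β : ℝ) * σ a b c μ)
          (fun i' k' (_ : ℝ) => S i' k') i ((-1 : ℤ) + ((j : ℕ) : ℤ)) 0) ≤ m := by
  intro S hv hout hcap hg
  -- the window coordinates of the window state are the window entries of the evaluation point
  have hy : ∀ k < 12, L (fun i (j : Fin 3) => S i ((-1 : ℤ) + ((j : ℕ) : ℤ))) k = pt S k := by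
    intro k hk
    obtain ⟨i, j, rfl⟩ := exists_window_index k hk
    rw [hL, hwin]
  have hPe : (Poly.eval (L (fun i (j : Fin 3) => S i ((-1 : ℤ) + ((j : ℕ) : ℤ)))) P : ℝ) =
      Poly.eval (pt S) P :=
    eval_congr P fun k hk => hy k (lt_of_lt_of_le hk hP)
  have hGe : (Poly.eval (L (fun i (j : Fin 3) => S i ((-1 : ℤ) + ((j : ℕ) : ℤ)))) G : ℝ) =
      Poly.eval (pt S) G :=
    eval_congr G fun k hk => hy k (lt_of_lt_of_le hk hG)
  have hv' : (Poly.eval (pt S) P : ℝ) ≤ 0 := by simpa only [hPe] using hv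
  have hg' : 0 < (Poly.eval (pt S) G : ℝ) := by simpa only [hGe] using hg
  have key := hsos (pt S) (by rw [h20]; exact Real.mul_self_sqrt zero_le_two)
    (by rw [h20]; exact Real.sqrt_nonneg 2) hv' hg'
    (fun i j => by rw [hwin]; exact hcap i j)
    (fun i => by rw [hbm]; exact hout i (-2) (Or.inl (by norm_num)))
    (fun i => by rw [hbp]; exact hout i 2 (Or.inr (by norm_num)))
  -- the Fréchet derivative paired with the window field is the Lie derivative at `pt S`
  rw [eval_lieDeriv] at key
  rw [SOSPolyCalculus.fderiv_eval_comp_apply]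
  refine le_of_eq_of_le (Finset.sum_congr rfl fun k hk => ?_) key
  have hk : k < numVars P := by simpa using hk
  have hk12 : k < 12 := lt_of_lt_of_le hk hP
  congr 1
  · exact eval_congr _ fun k' hk' => hy k' (lt_of_lt_of_le hk' ((numVars_pderiv_le k P).trans hP))
  · obtain ⟨i, j, rfl⟩ := exists_window_index k hk12
    rw [hL]
    exact quadTerm_pencil_window_eq_eval_field τ α₀ τ' σ hτ hα₀ hτ' hσ β F hF pt hwin hbm hbp h20 S i j

end Field

end TriggerWindow

end Summit.NavierStokesRegularity.NavierStokesRegularity.Theorems
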